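import Summits.HodgeConjecture.HodgeConjecture.Theorems.SignSymmetricPowersOrbitDataExchange
import Literature.AlgebraicGeometry.HodgeTheory.SignSymmetricOneSeedHodgeGroup
import HarnessLib

/-!
# Crux K1-B `VeryGeneralSignCommutatorsInHg` and the rung leaf modulo {hpg3∕PG, hPL⁻, hCDK, hN}: the Picard–Lefschetz binder WITHOUT
# Wall's sign rule (programme «W-ELIM» brick 4; route `SignSymmetricPowers`, item stmt-HodgeConjecture-19716)

Prover seat `hodge-nonav-19716-p2` (g10), cell `hodge-nonav`; helper `--supports stmt-HodgeConjecture-19716`; sorry-free, no definition, no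
new named fact.  P3 g34 GO BRICK 4 (STATUS 21:18:10Z).  VERBATIM port of the kernel and the compositions of `SignSymmetricPowersFourFactsN`
(g9, phase N-ONLY: K1-B ⟸ {hpg3, hPL, hCDK, hN}) with the binder hPL = `picardLefschetz_nodalForms_uniform` (flat coefficient + Wall's sign
rule (W) + exchange rule (O)) WEAKENED to hPL⁻ = `picardLefschetz_nodalForms_flatExchange` (flat coefficient + (O);
`Literature/…/PicardLefschetzNodalFormsFlat`, p672824).  The chain underneath: `SignSymmetricPowersMeridianGenerationNoPL` (GEN, PL-free),
`SignSymmetricPowersPencilTransvectionsExchange` (PEN, unsigned fixed centres), `PicardLefschetzSymmetricA3OfFlat` ∕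
`SignSymmetricPowersLinkConfluenceNFlat` ∕ `SignSymmetricPowersConfluenceLinkGNFlat` (Pair ∕ confluence ∕ LINK-G from the flat package),
`SignSymmetricPowersOrbitDataExchange` (GEO with parities from `eq_or_eq_neg_of_oneParamTransvection_comm`; envelope by
`signPencil_clauses_of_orbitData_unsigned` with both `τ`-eigenspaces non-zero by Shioda's count), and here the kernel on
`commutator_mem_hodgeGroup_of_signSymmetric_of_eigenCentres` (W-ELIM: one fixed seed suffices).  All theorem names carry the suffix `_exchange`.

* `veryGeneralSignCommutatorsInHg_of_genusBound_three_facts_exchange (hpg3) (hPL⁻) (hCDK) (hNC)` — **K1-B ⟸ {hpg3 (landed), hPL⁻, hCDK, hN}**;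
* `signThreefoldPowersHodge_of_genusBound_three_facts_exchange` — the rung-F-H1 leaf likewise; PG-variants.

Registry consequence (P3's call; this seat registers on its GO): 19716 v23 = {hPL⁻, hCDK, hN} — hPL⁻ is STRICTLY WEAKER than v22's hPL
(`picardLefschetz_nodalForms_flatExchange_of_uniform`): Wall's sign rule (AGZV II §5.1 Thm. 5.1) has left the hypotheses of route B; what a
geometric port must still supply is the symmetry-free Picard–Lefschetz package with a flat coefficient plus the exchange rule at swapped nodes.
CONDITIONAL; nothing here says HC ∕ HC_AV is proved; rung F-H1 not moved.
-/

noncomputable section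

set_option linter.dupNamespace false
set_option linter.unusedVariables false
set_option maxHeartbeats 800000

namespace Summit.HodgeConjecture.HodgeConjecture.Theorems.SignSymmetricPowersFourFactsExchange

open Literature.AlgebraicGeometry.Motives Literature.AlgebraicGeometry.HodgeTheory
open Literature.AlgebraicGeometry.HodgeTheory.BettiUniverse
open Literature.AlgebraicTopology.SingularHomology
open CategoryTheory
open Summit.HodgeConjecture.HodgeConjecture.Theorems.SignSymmetricPowersConfluenceLinkG (isSupportedOn_of_coeff_odd_eq_zero)
open Summit.HodgeConjecture.HodgeConjecture.Theorems.SignSymmetricPowersPencilOrbitData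
open Summit.HodgeConjecture.HodgeConjecture.Theorems.SignSymmetricPowersSevenFacts
open Literature.AlgebraicGeometry.FundamentalGroup (affineHypersurfaceComplement_meridians_normalClosure_eq_top_holds)
open Summit.HodgeConjecture.HodgeConjecture.Theorems.SignSymmetricPowersFourFactsGeometricGenus

/-- **K1-B `VeryGeneralSignCommutatorsInHg` from the deck Hodge numbers and the named facts {ZvK, hPL⁻, D1, hCDK, hN}, the PL binder
WITHOUT Wall's sign rule** (verbatim `SignSymmetricPowersFourFactsN.veryGeneralSignCommutatorsInHg_of_signDeckHodge_torus_N` with hPL weakened to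
`picardLefschetz_nodalForms_flatExchange`): the envelope is `signPencilEnvelope_exchange` (fixed centres of unknown sign) and Theorem A's
algebra is the W-ELIM kernel `commutator_mem_hodgeGroup_of_signSymmetric_of_eigenCentres` (`SignSymmetricOneSeedHodgeGroup`: one seed side
suffices, `U_{δ−σδ}(s) = U_{δ+σδ}(−s)·U_δ(2s)U_{σδ}(2s)`) instead of `commutator_mem_hodgeGroup_of_signSymmetric`.  CONDITIONAL result.
[cite: VoisinHodgeII2003, §6.1.3 Thm. 6.10 and Cor. 6.12] [cite: Deligne1980, §4.4 (4.4.1)–(4.4.4^α)] -/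
theorem veryGeneralSignCommutatorsInHg_of_signDeckHodge_exchange
    (hSDH : open Literature.AlgebraicGeometry.Motives Literature.AlgebraicGeometry.HodgeTheory Literature.AlgebraicGeometry.HodgeTheory.BettiUniverse CategoryTheory.Limits in let pmul2 : List (ℕ × ℕ) → List (ℕ × ℕ) → List (ℕ × ℕ) := fun a b => (List.range (a.length + b.length - 1)).map fun k => (((List.range (k + 1)).map fun i => (a.getD i (0, 0)).1 * (b.getD (k - i) (0, 0)).1 + (a.getD i (0, 0)).2 * (b.getD (k - i) (0, 0)).2).sum, ((List.range (k + 1)).map fun i => (a.getD i (0, 0)).1 * (b.getD (k - i) (0, 0)).2 + (a.getD i (0, 0)).2 * (b.getD (k - i) (0, 0)).1).sum); let fac : ℕ → Bool → List (ℕ × ℕ) := fun d odd => (List.range (d - 1)).map fun k => if odd ∧ ¬ Even k then (0, 1) else (1, 0); let shn : ℕ → ℕ → ℕ → ℕ := fun d j q => if (q + 1) * d < 5 then 0 else if j = 0 then (([fac d true, fac d false, fac d false, fac d false].foldl pmul2 (fac d true)).getD ((q + 1) * d - 5) (0, 0)).1 else (([fac d true, fac d false, fac d false, fac d false].foldl pmul2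 (fac d true)).getD ((q + 1) * d - 5) (0, 0)).2; ∀ ⦃d : ℕ⦄, Even d → 4 ≤ d → ∀ f : MvPolynomial (Fin 5) ℂ, f.IsHomogeneous d → (∀ e : Fin 5 →₀ ℕ, ¬ Even (e 0 + e 1) → f.coeff e = 0) → SmoothHypersurface.IsNonsingularForm ℂ f → ∀ (hXF : IsSmoothProjective 3 (SmoothHypersurface.hypersurface f)) (ha : (fun i : Fin 5 => if (i : ℕ) < 2 then (-1 : ℂˣ) else 1) ∈ diagonalStabilizer f), ∀ j q : ℕ, j < 2 → q ≤ 3 → Module.finrank ℂ ↥(Module.End.eigenspace ((pull (diagonalAut f ha) 3).baseChange ℂ) ((-1 : ℂ) ^ j) ⊓ (hodge exists_isReal_hodgeModel_holds hXF 3).piece ((3 : ℤ) - q) q) = shn d j q)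
    (hZvK : Literature.AlgebraicGeometry.FundamentalGroup.affineHypersurfaceComplement_meridians_normalClosure_eq_top)
    (hPL : Literature.AlgebraicGeometry.HodgeTheory.picardLefschetz_nodalForms_flatExchange)
    (hD1 : Literature.AlgebraicGeometry.HodgeTheory.discriminant_localBranches_nodal)
    (hCDK : Literature.AlgebraicGeometry.HodgeTheory.cmsp_nonHodgeGenericPoints_countable_algebraic_cover)
    (hNC : ∀ (n d : ℕ) (f₁ g₀ g₂ : MvPolynomial (Fin (n + 2)) ℂ) (j k : Fin (n + 2)) (a : Fin (n + 2) → ℂˣ),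
      1 ≤ n → 1 ≤ d → f₁.IsHomogeneous d → g₀.IsHomogeneous d → g₂.IsHomogeneous d → Literature.AlgebraicGeometry.HodgeTheory.IsSymmetricA3Datum f₁ g₀ g₂ j k a →
      ∀ (εa εb : ℝ) (ψ : ℂ → ℂ), Literature.AlgebraicGeometry.HodgeTheory.IsSymmetricA3Bifurcation f₁ g₀ g₂ j a εa εb ψ →
        ∃ εa' : ℝ, 0 < εa' ∧ εa' ≤ εa ∧ Literature.AlgebraicGeometry.HodgeTheory.SymmetricA3NonCommutation n d f₁ g₀ g₂ ψ εa') :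
    Summit.HodgeConjecture.HodgeConjecture.Theses.SignSymmetricPowers.VeryGeneralSignCommutatorsInHg := by
  have hMC : Literature.AlgebraicGeometry.FundamentalGroup.affineHypersurfaceComplement_meridian_isConj :=
    Literature.AlgebraicGeometry.FundamentalGroup.affineHypersurfaceComplement_meridian_isConj_holds
  refine Summit.HodgeConjecture.HodgeConjecture.Theorems.SignSymmetricPowersModelTransfer.stub_modelTransfer ?_
  intro d hd h4d
  obtain ⟨𝒳, S, u, hu, h𝒳, hqp, hsm, hirr, hU, A, hA, hfin, pt, hALG, hMEM⟩ :=
    SignSymmetricPowersOrbitDataExchange.signPencilEnvelope_exchange hZvK hPL hD1 hNC hMC hd h4d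
  haveI hHTF : HodgeTensorFacts.{0, 0} := hodgeTensorFacts_holds
  haveI : ∀ t : ComplexPoints S, Module.Finite ℚ (bettiCohomology (fiberOver u t) 3) := hfin
  -- the Cattani–Deligne–Kaplan cover of the non-Hodge-generic points of the base
  obtain ⟨W, hW, hcov⟩ := hCDK u 3 3 hu hqp hsm hirr hU A hA
  -- each member of the cover is avoided off one nonzero polynomial condition on the ι-even coefficients
  choose G hG₀ hG using fun j => hALG (W j) (hW j).1 (hW j).2
  -- v5: prepend the nonsingular-avoidance polynomial `g₀`, so that very general members are NONSINGULAR FORMS (this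
  -- excludes the degenerate corners `f = c·G^k`, `k ≥ 2`, where `V₊(f)_red` is a smooth threefold of lower degree)
  obtain ⟨g₀, hg₀, hNSg⟩ := Summit.HodgeConjecture.HodgeConjecture.Theorems.SignSymmetricPowersNonsingularAvoidance.stub_signNonsingularAvoidance hd h4d
  refine ⟨fun i => if i = 0 then g₀ else G (i - 1), ?_, ?_⟩
  · intro i
    by_cases hi : i = 0
    · simpa only [hi, if_true] using hg₀
    · simpa only [hi, if_false] using hG₀ (i - 1)
  intro f hf hev hgen' hXF ha
  have hJ : SmoothHypersurface.IsNonsingularForm ℂ f := hNSg f hf (by simpa only [if_true] using hgen' 0)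
  have hgen : ∀ j, MvPolynomial.eval (fun e : {e : Fin 5 →₀ ℕ // e.degree = d} => f.coeff e.1) (G j) ≠ 0 := fun j => by
    simpa only [Nat.succ_ne_zero, if_false, Nat.add_sub_cancel] using hgen' (j + 1)
  -- Deck clauses: `σ_f^{*2} = 1` and `σ_f^*` a `tr ∘ cup` isometry (tree), and the deck Hodge numbers from `hSDH`
  obtain ⟨ha', h1, h2⟩ := exists_signDeckModel_clauses_one_two f hev hXF
  refine ⟨⟨h1, h2, hSDH hd h4d f hf hev hJ hXF ha'⟩, ?_⟩
  intro g h hg hh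
  obtain ⟨φ, B, hB, hBn, τ, hτ, T, D, hNon, hτB, hφτ, hφB, hHG, hT, hD, hTsign, hseed, hspanPos, hconnPos,
    hspanNeg, hconnNeg⟩ := hMEM f hf hev hJ hXF ha
  haveI := finite hXF 3
  haveI : Nontrivial (bettiCohomology (fiberOver u (pt f)) 3) := hNon
  -- the classifying point of a very general member is Hodge generic
  have hsgen : IsHodgeGenericPoint u 3 hU hu A hA ⟨pt f, Set.mem_univ _⟩ := by
    by_contra hns
    obtain ⟨j, hj⟩ := hcov ⟨pt f, Set.mem_univ _⟩ hns
    exact hG j f hf hev hXF (hgen j) hj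
  -- CMSP 15.3.7 (ii), now a THEOREM (quasi-projective total space, irreducible base): the algebraic monodromy group
  -- `Mon⁰ = (Γ^Zar)⁰` lies in the Mumford–Tate group of the fibre
  have hΓ : glIdentityComponent (ratMonodromyGroup u 3 hU ⟨pt f, Set.mem_univ _⟩) ⊆
      (((A (pt f)).hodgeStructure (hu.isSmoothProjective (pt f)) (hA (pt f)) 3).mumfordTateGroup : Set (bettiCohomology (fiberOver u (pt f)) 3 ≃ₗ[ℚ] bettiCohomology (fiberOver u (pt f)) 3)) :=
    (deligne_finiteIndex_monodromy_le_mumfordTateGroup_of_isQuasiProjectiveOver u 3 3 hu h𝒳 hqp hsm hirr hU A hA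
      ⟨pt f, Set.mem_univ _⟩ hsgen).2
  -- transport the two σ-centraliser isometries to the fibre
  have hστ : ∀ y, τ (φ.symm y) = φ.symm (pull (diagonalAut f ha) 3 y) := fun y => by
    apply φ.injective
    rw [hφτ, LinearEquiv.apply_symm_apply, LinearEquiv.apply_symm_apply]
  have cenτ : ∀ k : bettiCohomology (SmoothHypersurface.hypersurface f) 3 ≃ₗ[ℚ] bettiCohomology (SmoothHypersurface.hypersurface f) 3,
      (∀ x, k (pull (diagonalAut f ha) 3 x) = pull (diagonalAut f ha) 3 (k x)) →
      ∀ x, ((φ.trans k).trans φ.symm) (τ x) = τ (((φ.trans k).trans φ.symm) x) := by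
    intro k hk x
    simp only [LinearEquiv.trans_apply]
    rw [hφτ, hk, hστ]
  have cenB : ∀ k : bettiCohomology (SmoothHypersurface.hypersurface f) 3 ≃ₗ[ℚ] bettiCohomology (SmoothHypersurface.hypersurface f) 3,
      (∀ x y, tr hXF (3 + 3) (cup (SmoothHypersurface.hypersurface f) 3 3 (k x) (k y)) = tr hXF (3 + 3) (cup (SmoothHypersurface.hypersurface f) 3 3 x y)) →
      ∀ x y, B (((φ.trans k).trans φ.symm) x) (((φ.trans k).trans φ.symm) y) = B x y := by
    intro k hk x y
    simp only [LinearEquiv.trans_apply]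
    rw [hφB, LinearEquiv.apply_symm_apply, LinearEquiv.apply_symm_apply, hk, ← hφB]
  -- Theorem A's algebra with fixed centres of UNKNOWN sign (W-ELIM kernel, landed): commutators of the sign-symmetric
  -- centraliser of the fibre lie in its Hodge group
  have hcomm := commutator_mem_hodgeGroup_of_signSymmetric_of_eigenCentres
    ((A (pt f)).hodgeStructure (hu.isSmoothProjective (pt f)) (hA (pt f)) 3)
    (smoothProjective_hodgeStructure_isPolarizable_holds (hu.isSmoothProjective (pt f)) (A (pt f))
      (hA (pt f)) 3) ⟨1, by norm_num⟩ hB hBn hτ hτB hΓ hT hD hTsign hseed hspanPos hconnPos hspanNeg hconnNeg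
    (cenτ g hg.1) (cenB g hg.2) (cenτ h hh.1) (cenB h hh.2)
  -- transport back to `H³(X_f;ℚ)` along `φ` (Hodge groups correspond)
  have hback := hHG _ hcomm
  have hid : (φ.symm.trans (((φ.trans g).trans φ.symm) * ((φ.trans h).trans φ.symm) *
      ((φ.trans g).trans φ.symm)⁻¹ * ((φ.trans h).trans φ.symm)⁻¹)).trans φ = g * h * g⁻¹ * h⁻¹ := by
    have hinv : ∀ k : bettiCohomology (SmoothHypersurface.hypersurface f) 3 ≃ₗ[ℚ] bettiCohomology (SmoothHypersurface.hypersurface f) 3,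
        ((φ.trans k).trans φ.symm)⁻¹ = (φ.trans k⁻¹).trans φ.symm := by
      intro k
      rw [inv_eq_iff_mul_eq_one]
      ext x
      simp
    rw [hinv, hinv]
    ext x
    simp
  rw [hid] at hback
  exact hback

/-- **Crux K1-B `VeryGeneralSignCommutatorsInHg` modulo {`h^{3,0} ≤ C(d−1,4)` (inlined), hPL⁻, hCDK, hNC}** — hPL⁻ = `picardLefschetz_nodalForms_flatExchange`
(no Wall sign rule): the kernel `veryGeneralSignCommutatorsInHg_of_signDeckHodge_exchange` fed `signDeckHodge_of_genusBound hpg3`, with ZvK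
and the nodal local branches of the discriminant supplied by their tree theorems. CONDITIONAL; nothing here says HC ∕ HC_AV is proved. [cite: Arapura2012, §17.3 (17.3.1)]
[cite: VoisinHodgeII2003, §6.1.3 Cor. 6.12] [cite: CattaniDeligneKaplan1995, Thm. 1.1 and Cor. 1.2] -/
theorem veryGeneralSignCommutatorsInHg_of_genusBound_three_facts_exchange
    (hpg3 : ∀ ⦃d : ℕ⦄ (f : MvPolynomial (Fin 5) ℂ), f.IsHomogeneous d → SmoothHypersurface.IsNonsingularForm ℂ f →
      ∀ (hXF : IsSmoothProjective 3 (SmoothHypersurface.hypersurface f)),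
        Module.finrank ℂ ↥((BettiUniverse.hodge exists_isReal_hodgeModel_holds hXF 3).piece 3 0) ≤ (d - 1).choose 4)
    (hPL : Literature.AlgebraicGeometry.HodgeTheory.picardLefschetz_nodalForms_flatExchange)
    (hCDK : Literature.AlgebraicGeometry.HodgeTheory.cmsp_nonHodgeGenericPoints_countable_algebraic_cover)
    (hNC : ∀ (n d : ℕ) (f₁ g₀ g₂ : MvPolynomial (Fin (n + 2)) ℂ) (j k : Fin (n + 2)) (a : Fin (n + 2) → ℂˣ),
      1 ≤ n → 1 ≤ d → f₁.IsHomogeneous d → g₀.IsHomogeneous d → g₂.IsHomogeneous d → Literature.AlgebraicGeometry.HodgeTheory.IsSymmetricA3Datum f₁ g₀ g₂ j k a →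
      ∀ (εa εb : ℝ) (ψ : ℂ → ℂ), Literature.AlgebraicGeometry.HodgeTheory.IsSymmetricA3Bifurcation f₁ g₀ g₂ j a εa εb ψ →
        ∃ εa' : ℝ, 0 < εa' ∧ εa' ≤ εa ∧ Literature.AlgebraicGeometry.HodgeTheory.SymmetricA3NonCommutation n d f₁ g₀ g₂ ψ εa') :
    Summit.HodgeConjecture.HodgeConjecture.Theses.SignSymmetricPowers.VeryGeneralSignCommutatorsInHg :=
  veryGeneralSignCommutatorsInHg_of_signDeckHodge_exchange
    (signDeckHodge_of_genusBound hpg3) affineHypersurfaceComplement_meridians_normalClosure_eq_top_holds @hPL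
    discriminant_localBranches_nodal_holds @hCDK @hNC

/-- **Crux K1-B `VeryGeneralSignCommutatorsInHg` modulo {PG, hPL⁻, hCDK, hNC}** (PG = `Arapura2012_hypersurface_geometricGenus`, shared
with K1-A; hPL⁻ = `picardLefschetz_nodalForms_flatExchange`). CONDITIONAL; nothing here says HC ∕ HC_AV is proved. [cite: Arapura2012, §17.3 (17.3.1)]
[cite: VoisinHodgeII2003, §6.1.3 Cor. 6.12] [cite: CattaniDeligneKaplan1995, Thm. 1.1 and Cor. 1.2] -/
theorem veryGeneralSignCommutatorsInHg_of_geometricGenus_three_facts_exchange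
    (hPG : Literature.AlgebraicGeometry.HodgeTheory.Arapura2012_hypersurface_geometricGenus)
    (hPL : Literature.AlgebraicGeometry.HodgeTheory.picardLefschetz_nodalForms_flatExchange)
    (hCDK : Literature.AlgebraicGeometry.HodgeTheory.cmsp_nonHodgeGenericPoints_countable_algebraic_cover)
    (hNC : ∀ (n d : ℕ) (f₁ g₀ g₂ : MvPolynomial (Fin (n + 2)) ℂ) (j k : Fin (n + 2)) (a : Fin (n + 2) → ℂˣ),
      1 ≤ n → 1 ≤ d → f₁.IsHomogeneous d → g₀.IsHomogeneous d → g₂.IsHomogeneous d → Literature.AlgebraicGeometry.HodgeTheory.IsSymmetricA3Datum f₁ g₀ g₂ j k a →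
      ∀ (εa εb : ℝ) (ψ : ℂ → ℂ), Literature.AlgebraicGeometry.HodgeTheory.IsSymmetricA3Bifurcation f₁ g₀ g₂ j a εa εb ψ →
        ∃ εa' : ℝ, 0 < εa' ∧ εa' ≤ εa ∧ Literature.AlgebraicGeometry.HodgeTheory.SymmetricA3NonCommutation n d f₁ g₀ g₂ ψ εa') :
    Summit.HodgeConjecture.HodgeConjecture.Theses.SignSymmetricPowers.VeryGeneralSignCommutatorsInHg :=
  veryGeneralSignCommutatorsInHg_of_genusBound_three_facts_exchange (genusBound_of_geometricGenus hPG) @hPL @hCDK @hNC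

/-- **The rung leaf `SignThreefoldPowersHodge` modulo {PG, hPL⁻, hCDK, hNC}** (composition with the landed
`signThreefoldPowersHodge_of_veryGeneralSignCommutatorsInHg`). CONDITIONAL; rung F-H1 not moved. [cite: Arapura2012, §17.3 (17.3.1)]
[cite: CattaniDeligneKaplan1995, Thm. 1.1 and Cor. 1.2] -/
theorem signThreefoldPowersHodge_of_geometricGenus_three_facts_exchange
    (hPG : Literature.AlgebraicGeometry.HodgeTheory.Arapura2012_hypersurface_geometricGenus)
    (hPL : Literature.AlgebraicGeometry.HodgeTheory.picardLefschetz_nodalForms_flatExchange)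
    (hCDK : Literature.AlgebraicGeometry.HodgeTheory.cmsp_nonHodgeGenericPoints_countable_algebraic_cover)
    (hNC : ∀ (n d : ℕ) (f₁ g₀ g₂ : MvPolynomial (Fin (n + 2)) ℂ) (j k : Fin (n + 2)) (a : Fin (n + 2) → ℂˣ),
      1 ≤ n → 1 ≤ d → f₁.IsHomogeneous d → g₀.IsHomogeneous d → g₂.IsHomogeneous d → Literature.AlgebraicGeometry.HodgeTheory.IsSymmetricA3Datum f₁ g₀ g₂ j k a →
      ∀ (εa εb : ℝ) (ψ : ℂ → ℂ), Literature.AlgebraicGeometry.HodgeTheory.IsSymmetricA3Bifurcation f₁ g₀ g₂ j a εa εb ψ →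
        ∃ εa' : ℝ, 0 < εa' ∧ εa' ≤ εa ∧ Literature.AlgebraicGeometry.HodgeTheory.SymmetricA3NonCommutation n d f₁ g₀ g₂ ψ εa') :
    Summit.HodgeConjecture.HodgeConjecture.Theses.SignSymmetricPowers.SignThreefoldPowersHodge :=
  SignSymmetricPowersSignThreefoldPowersHodge.signThreefoldPowersHodge_of_veryGeneralSignCommutatorsInHg
    (veryGeneralSignCommutatorsInHg_of_geometricGenus_three_facts_exchange @hPG @hPL @hCDK @hNC)

/-- The same rung leaf modulo {`h^{3,0} ≤ C(d−1,4)` (inlined), hPL⁻, hCDK, hNC}. CONDITIONAL; rung F-H1 not moved.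
[cite: Arapura2012, §17.3 (17.3.1)] [cite: CattaniDeligneKaplan1995, Thm. 1.1 and Cor. 1.2] -/
theorem signThreefoldPowersHodge_of_genusBound_three_facts_exchange
    (hpg3 : ∀ ⦃d : ℕ⦄ (f : MvPolynomial (Fin 5) ℂ), f.IsHomogeneous d → SmoothHypersurface.IsNonsingularForm ℂ f →
      ∀ (hXF : IsSmoothProjective 3 (SmoothHypersurface.hypersurface f)),
        Module.finrank ℂ ↥((BettiUniverse.hodge exists_isReal_hodgeModel_holds hXF 3).piece 3 0) ≤ (d - 1).choose 4)
    (hPL : Literature.AlgebraicGeometry.HodgeTheory.picardLefschetz_nodalForms_flatExchange)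
    (hCDK : Literature.AlgebraicGeometry.HodgeTheory.cmsp_nonHodgeGenericPoints_countable_algebraic_cover)
    (hNC : ∀ (n d : ℕ) (f₁ g₀ g₂ : MvPolynomial (Fin (n + 2)) ℂ) (j k : Fin (n + 2)) (a : Fin (n + 2) → ℂˣ),
      1 ≤ n → 1 ≤ d → f₁.IsHomogeneous d → g₀.IsHomogeneous d → g₂.IsHomogeneous d → Literature.AlgebraicGeometry.HodgeTheory.IsSymmetricA3Datum f₁ g₀ g₂ j k a →
      ∀ (εa εb : ℝ) (ψ : ℂ → ℂ), Literature.AlgebraicGeometry.HodgeTheory.IsSymmetricA3Bifurcation f₁ g₀ g₂ j a εa εb ψ →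
        ∃ εa' : ℝ, 0 < εa' ∧ εa' ≤ εa ∧ Literature.AlgebraicGeometry.HodgeTheory.SymmetricA3NonCommutation n d f₁ g₀ g₂ ψ εa') :
    Summit.HodgeConjecture.HodgeConjecture.Theses.SignSymmetricPowers.SignThreefoldPowersHodge :=
  SignSymmetricPowersSignThreefoldPowersHodge.signThreefoldPowersHodge_of_veryGeneralSignCommutatorsInHg
    (veryGeneralSignCommutatorsInHg_of_genusBound_three_facts_exchange hpg3 @hPL @hCDK @hNC)

end Summit.HodgeConjecture.HodgeConjecture.Theorems.SignSymmetricPowersFourFactsExchange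

end
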